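import Literature.AlgebraicGeometry.Motives.EtaleToProetIndEtaleAlgebra
import Literature.RingTheory.Etale.WeaklyEtaleIndEtaleCover

/-!
# Étale cohomology equals pro-étale cohomology of the pulled-back sheaf (Bhatt–Scholze 5.1.6)

[cite: BhattScholze2015 = arXiv:1309.1198v2, Corollary 5.1.6, Lemma 5.1.2, Theorem 2.3.4]

We discharge `nonempty_addEquiv_sheafH_etaleToProetPullback` (Bhatt–Scholze, Cor. 5.1.6:
`H^i(X_ét, F) ≅ H^i(X_proét, ν^* F)` for abelian étale sheaves).  The tree reduces it
(`nonempty_addEquiv_sheafH_etaleToProetPullback_of_indEtale`: Čech comparison on w-contractible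
affine covers, Lemma 5.1.2 / 4.2.4) to Bhatt–Scholze's Theorem 2.3.4 for rings, which is
`Literature.RingTheory.Etale.exists_indEtale_faithfullyFlat_of_weaklyEtale`: a weakly étale
`A → B` admits a faithfully flat `B → C` with `A → C` ind-étale (then `B → C` is weakly étale by
cancellation, `weaklyEtale_cancel`).
-/

universe u

open CategoryTheory CategoryTheory.Limits AlgebraicGeometry Literature.RingTheory.Etale

namespace Literature.AlgebraicGeometry.Motives

/-- **Bhatt–Scholze, Corollary 5.1.6.** For a scheme `X`, an abelian étale sheaf `F` and
`i : ℕ`, `H^i(X_ét, F) ≃+ H^i(X_proét, ν^* F)`. [cite: BhattScholze2015, Corollary 5.1.6] -/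
theorem nonempty_addEquiv_sheafH_etaleToProetPullback_holds :
    nonempty_addEquiv_sheafH_etaleToProetPullback.{u} := by
  refine nonempty_addEquiv_sheafH_etaleToProetPullback_of_indEtale fun A B φ hφ => ?_
  letI : Algebra A B := φ.hom.toAlgebra
  haveI : Algebra.WeaklyEtale A B := hφ
  obtain ⟨C, _, _, ψ, hFE, hff⟩ := exists_indEtale_faithfullyFlat_of_weaklyEtale A B
  have hAC : IsIndEtale A C := hFE.exists_directLimit_equiv
  obtain ⟨J, _, _, D, hD, c, hc, e, he⟩ := IsIndEtale.exists_isColimit (A := A) hAC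
  let g : B ⟶ c.pt := CommRingCat.ofHom ψ.toRingHom ≫ e.inv
  have hφ' : φ = CommRingCat.ofHom (algebraMap A B) := by
    ext x
    rfl
  refine ⟨J, inferInstance, inferInstance, D, hD, c, hc, g, fun j => ?_, ?_, ?_⟩
  · -- compatibility `A → D_j → colim = A → B → colim`
    have h1 : (D.obj j).hom ≫ c.ι.app j = CommRingCat.ofHom (algebraMap A C) ≫ e.inv := by
      refine (Iso.eq_comp_inv e).2 ?_
      exact he j
    have h2 : φ ≫ CommRingCat.ofHom ψ.toRingHom = CommRingCat.ofHom (algebraMap A C) := by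
      rw [hφ', ← CommRingCat.ofHom_comp]
      congr 1
      ext a
      exact ψ.commutes a
    refine h1.trans ?_
    rw [← h2, Category.assoc]
  · -- `B → colim` is faithfully flat
    refine (RingHom.FaithfullyFlat.respectsIso.cancel_right_isIso _ _).2 ?_
    rw [CommRingCat.hom_ofHom]
    exact hff
  · -- `B → colim` is weakly étale, by cancellation from `A → C` ind-étale
    letI : Algebra B C := ψ.toRingHom.toAlgebra
    haveI : IsScalarTower A B C := IsScalarTower.of_algebraMap_eq fun a => (ψ.commutes a).symm
    haveI : Algebra.WeaklyEtale A C := hFE.weaklyEtale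
    haveI : Algebra.WeaklyEtale B C := weaklyEtale_cancel A B C
    letI : Algebra B c.pt := g.hom.toAlgebra
    let e' : C ≃ₐ[B] c.pt :=
      { e.symm.commRingCatIsoToRingEquiv with
        commutes' := fun b => rfl }
    exact weaklyEtale_of_algEquiv e'

end Literature.AlgebraicGeometry.Motives
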